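import Summits.KontsevichZagierPeriods.KontsevichZagierPeriods.Theses.UnfoldedStokes
import Summits.KontsevichZagierPeriods.KontsevichZagierPeriods.Theorems.StokesGeneration.Negative.CovDomainAddLoadBearing
import Summits.KontsevichZagierPeriods.KontsevichZagierPeriods.Theorems.CompleteModGammaSector.Negative.DimZeroInvariant
import Summits.KontsevichZagierPeriods.KontsevichZagierPeriods.Theorems.StuffleInKZ.Negative.IntegrandAdditivityDerived
import Summits.KontsevichZagierPeriods.KontsevichZagierPeriods.Theorems.UnfoldedStokesStokesGenerationStubCubifyKernel
import Literature.NumberTheory.Transcendental.KZLogCalculusProofs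
import Literature.NumberTheory.Transcendental.KZKernelConjectureForms
import Literature.NumberTheory.Transcendental.KZMellinFibres

/-!
# Disproof of `ContinuousCubification` (stmt-KontsevichZagierPeriods-17853) — findings

Standing disprover's work file (cdisprove, cycle 1, 2026-08-17). Prose only in docstrings; every
claim below is kernel-checked unless marked `sorry` (near-misses, §E — none so far).

Crux (route UnfoldedStokes, piece 1/3 of the BC2 split of `StokesGeneration`):
`∀ x : FormalRep, ∃ M (t : IntegralRep M), t.domain = [0,1]^M ∧ ContinuousOn t.integrand t.domain ∧
x − [t] ∈ KZ.relations` — CONTINUOUS CUBIFICATION MODULO THE MOVES.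

**Verdict of cycle 1: NO KILL, and none is cheap.** The crux has no hypotheses to drop; its only
structural datum is the move set `relations = closure ((1a) ∪ (1b) ∪ (2) ∪ (3))`. An additive
invariant refuting it would have to kill all four move sets and be non-zero on `x − [t]` for EVERY
continuous closed-cube `t`; since continuous closed-cube representations realise every value that
the printed geometry predicts (Viu-Sos compactification + `C¹` charts, or CAD flattening + one
boundary-damping change of variables, §D), such an invariant is of period-conjecture type. What IS
provable is the complete load-bearing picture of the generator list (§A) and the calibration of the
natural strengthenings (§C).

## Findings (index)

* §0 CALIBRATION — `continuousCubification_iff` (`Iff.rfl` unfolding); the crux is a NORMAL-FORM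
  statement: no `eval x = 0` hypothesis, not implied by and not implying the summit by logic.
  SANDWICH: `ValueCubification ∧ KZKernelConjecture → ContinuousCubification → ValueCubification`
  (`continuousCubification_of_kernel`, `valueCubification_of_continuousCubification`), where
  `ValueCubification` (every `eval x` is the value of a continuous closed-cube representation) is
  the printed value-level theorem (Viu-Sos 2021 Thm 1.1 + Ohmoto–Shiota 2017 Thm 1.1 over the real
  closure of `ℚ`; not formalised). Hence `not_summit_of_not_continuousCubification`: modulo that
  printed theorem, ANY refutation of the crux refutes the summit `KontsevichZagierPeriods` — the
  crux is not cheaper to kill than Conjecture 1 itself.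
  `cubeNormalForm_relations`: the crux MINUS continuity is a theorem (landed `stub_cubifyKernel`,
  p120281) — continuity on the CLOSED cube is the whole content.
* §A LOAD-BEARING ANALYSIS of the four move sets (the crux has no other hypothesis):
  - rule (3) Newton–Leibniz: LOAD-BEARING, unconditional, in the strongest form — without it there is
    NO single-representation normal form at all (`not_singleRepNormalForm_rulesOneTwo`; invariants
    `ev₀` = value of the dimension-0 part and `eval`; witness `[pt,1] + [[0,1],1]`), hence
    `continuousCubification_false_without_newtonLeibniz`.
  - rule (2) change of variables: LOAD-BEARING, unconditional — without it no formal combination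
    supported in `{x₀ ≥ 2}` with a non-semialgebraic distribution function reaches the unit cube
    (`not_cubeNormalForm_rulesOneThree`; tree invariant `covKer` — first-coordinate distribution
    function `ℝ`-semialgebraic on the window `[2,3]`; witness `[[2,3], 1/(4−t)]`, value `log 2`),
    hence `continuousCubification_false_without_changeOfVariables`. Rule (2) is needed ALREADY TO
    TRANSLATE a domain into the cube, before any regularity question.
  - rule (1a) domain additivity: LOAD-BEARING modulo the named fact `Dries1998_ch4_prop_2_4`
    (invariance of the o-minimal Euler characteristic under injective definable maps) —
    `not_cubeNormalForm_rulesNoDomainAdd hE` (tree invariant `evenEulerEval`; NEW here: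
    `realEuler_closedCube : E([0,1]^M) = 1`, so every closed-cube representation is invisible;
    witness `[[0,1]∪[2,3], 1]`, `E = 2`), hence `continuousCubification_false_without_domainAdd hE`.
  - rule (1b) integrand additivity: REDUNDANT (tree: `relations_eq_closure_three_rules`), so the
    crux without (1b) is EQUIVALENT to the crux (`continuousCubification_iff_threeRules`).
  UPSHOT: any proof uses (1a), (2), (3) essentially; the registered line does (rule (1a) over top
  simplices, rule (2) per simplex chart, rule (3) in the landed slab lifts / Viu-Sos reduction).
  LANDED: §A + §C as `Theorems/ContinuousCubification/Negative/LoadBearing.lean` (p146663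
  ACCEPTED, commit 55929359f844; namespace `Summit.KontsevichZagierPeriods.UnfoldedStokes.
  ContinuousCubificationNegative` — ideators/planners may import it).
* §B TIGHTNESS — `cubeNormalForm_relations` (bounded/unrestricted cube normal form is landed);
  §B.2 THE CORNER OBSTRUCTION `not_exists_continuousOn_closedSquare_extension`: the bounded,
  open-square-continuous, `ℚ`-semialgebraic `2x²/(x²+y²)` agrees with no function continuous on the
  closed square — so the open-cube normal form (free from CAD flattening) does not close up to the
  crux by null-set bookkeeping; the last step must be a genuine move (proposed as
  `Negative/CornerObstruction.lean`, p148402 ACCEPTED). The dimension cannot be pinned to `M = 0` for transcendental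
  values (recorded, needs `π ∉ ℚ̄`, not in Mathlib — no Lean claim made).
* §C NATURAL STRENGTHENINGS —
  - SIGN-RESPECTING continuous cubification (`t.integrand ≥ 0` whenever `eval x ≥ 0`) is
    SUMMIT-HARD: `kzKernelConjecture_of_signed : SignedContinuousCubification → KZKernelConjecture`
    (a non-negative continuous integrand of integral `0` vanishes on the closed cube, so `x ∈
    relations`). Planners: do not ask for positivity of the normal form.
  - boundary-VANISHING continuous cubification is NOT stronger: it follows from the crux by one
    rule-(2) smoothstep self-map of the open cube (the ideators' `damping`, SketchIdeator1.lean,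
    sorry-free there; not re-proved here).
* §D TARGETS (registered skeleton `Cruxes/StokesGeneration/Lines/c0_cubification.lean`, stubs
  `stub_c1TriangulationRat`, `stub_cubifyCompactSolidPair`; payload.targets empty this cycle) — no
  stub broken; per-stub attack notes in the §D docstring (degenerate `N = 0, 1`, empty interior,
  rank drop of `d(f|σ)` on `∂σ` harmless for rule (2) as typed, `n ≠ N` ambient dimension of `K`
  harmless, empty complex allowed).
* §E NEAR-MISSES — none sorried.

WHY IT RESISTS. (i) Value level: continuous closed-cube representations realise every real period
(Viu-Sos 2021 Thm 1.1 + `C¹` triangulation, Ohmoto–Shiota 2017 Thm 1.1, valid over any real closed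
field), so no value/arithmetic invariant separates. (ii) Move level: every additive invariant of
`FormalRep` in the tree that kills three of the four move sets dies on the fourth (`ev₀` on (3),
`covKer` on (2), `evenEulerEval` on (1a)), and each of them VANISHES on all closed-cube generators
— so they measure exactly which rule a cubification must use, and nothing more. (iii) The cheap
structural kill — a bounded open-cube-continuous semialgebraic integrand with no continuous extension
to the closed cube (`2x²/(x²+y²)` at the corner) — is real but is absorbed by ONE rule-(2) move with
boundary-vanishing Jacobian (smoothstep damping), so "continuous on the open cube + bounded" already
implies the crux; and THAT normal form follows from `stub_cubifyKernel` by `C¹` cylindrical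
decomposition and cell flattening (Jacobian = product of fibre widths, bounded). A refutation would
therefore have to break `C¹`-CAD over `ℚ` — a theorem (BCR Thm 2.3.6 / 9.1 over any RCF).
-/

noncomputable section

set_option linter.dupNamespace false

namespace Summit.KontsevichZagierPeriods.KontsevichZagierPeriods.Cruxes.ContinuousCubification.Disproof

open MeasureTheory Set Filter
open scoped Topology
open MvPolynomial (aeval X C)
open Literature.NumberTheory.Transcendental
open Literature.NumberTheory.Transcendental.KZ
open Literature.ModelTheory.ExponentialFields
open Summit.KontsevichZagierPeriods.KontsevichZagierPeriods.Theses.UnfoldedStokes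
  (ContinuousCubification)
open Summit.KontsevichZagierPeriods.CompleteModGammaSectorNegative
open Summit.KontsevichZagierPeriods.UnfoldedStokes.StokesGenerationNegative
  (of_mem_covKer_of_first_le_two)
open Literature.Barriers.KontsevichZagierPeriods.KZ (constRep constRep_value)
open Summit.KontsevichZagierPeriods.KontsevichZagierPeriods.Cruxes.StokesGeneration.FibrewiseStokes
  (stub_cubifyKernel)
open Summit.KontsevichZagierPeriods.KontsevichZagierPeriods.StokesGenerationLine
  (isSemialgebraic_cubePi)
open FirstOrder FirstOrder.Language

/-- The closed unit cube `[0,1]^M` in the crux's own spelling. -/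
abbrev cube (M : ℕ) : Set (Fin M → ℝ) := Set.pi Set.univ (fun _ : Fin M => Set.Icc (0:ℝ) 1)

/-! ## §0 Calibration -/

/-- The crux, unfolded (by `Iff.rfl`): a one-cube normal form with continuous integrand modulo
`relations`. No hypothesis on `x`; the only structural datum is the subgroup `relations`.
[cite: KontsevichZagier2001, §1.2] -/
theorem continuousCubification_iff :
    ContinuousCubification ↔ ∀ x : FormalRep, ∃ (M : ℕ) (t : IntegralRep M),
      t.domain = cube M ∧ ContinuousOn t.integrand t.domain ∧ x - of t ∈ relations :=
  Iff.rfl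

/-- One-cube normal form modulo a subgroup `H`, with NO regularity asked of the integrand. -/
def CubeNormalForm (H : AddSubgroup FormalRep) : Prop :=
  ∀ x : FormalRep, ∃ (M : ℕ) (t : IntegralRep M), t.domain = cube M ∧ x - of t ∈ H

/-- Single-representation normal form modulo `H` (no condition on the representation at all). -/
def SingleRepNormalForm (H : AddSubgroup FormalRep) : Prop :=
  ∀ x : FormalRep, ∃ (M : ℕ) (t : IntegralRep M), x - of t ∈ H

/-- The crux with `relations` replaced by an arbitrary subgroup `H` (used below with `H` = the
closure of three of the four move sets). -/
def ContinuousCubificationMod (H : AddSubgroup FormalRep) : Prop :=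
  ∀ x : FormalRep, ∃ (M : ℕ) (t : IntegralRep M),
    t.domain = cube M ∧ ContinuousOn t.integrand t.domain ∧ x - of t ∈ H

/-- `ContinuousCubificationMod relations` is the crux. [folklore] -/
theorem continuousCubificationMod_relations_iff :
    ContinuousCubificationMod relations ↔ ContinuousCubification := Iff.rfl

/-- Forgetting continuity. [folklore] -/
theorem cubeNormalForm_of_continuousCubificationMod {H : AddSubgroup FormalRep}
    (h : ContinuousCubificationMod H) : CubeNormalForm H := fun x => by
  obtain ⟨M, t, hd, -, hx⟩ := h x
  exact ⟨M, t, hd, hx⟩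

/-- Forgetting the cube. [folklore] -/
theorem singleRepNormalForm_of_cubeNormalForm {H : AddSubgroup FormalRep} (h : CubeNormalForm H) :
    SingleRepNormalForm H := fun x => by
  obtain ⟨M, t, -, hx⟩ := h x
  exact ⟨M, t, hx⟩

/-- Monotonicity in the subgroup. [folklore] -/
theorem ContinuousCubificationMod.mono {H H' : AddSubgroup FormalRep} (hle : H ≤ H')
    (h : ContinuousCubificationMod H) : ContinuousCubificationMod H' := fun x => by
  obtain ⟨M, t, hd, hc, hx⟩ := h x
  exact ⟨M, t, hd, hc, hle hx⟩

/-- VALUE-LEVEL cubification: every value `eval x` is the value of a continuous closed-cube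
representation. This is the printed theorem behind the crux (Viu-Sos 2021, Thm 1.1: periods are
differences of volumes of compact `ℚ̄ ∩ ℝ`-semialgebraic sets; Ohmoto–Shiota 2017, Thm 1.1: `C¹`
triangulation over any real closed field; pull back to top simplices and to the cube by the
polynomial stick-breaking map) — recorded as a `Prop`, NOT claimed in Lean.
[cite: OhmotoShiota2017, Thm. 1.1] -/
def ValueCubification : Prop :=
  ∀ x : FormalRep, ∃ (M : ℕ) (t : IntegralRep M),
    t.domain = cube M ∧ ContinuousOn t.integrand t.domain ∧ t.value = eval x

/-- The crux implies its value-level shadow (soundness of the calculus). [folklore] -/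
theorem valueCubification_of_continuousCubification (h : ContinuousCubification) :
    ValueCubification := fun x => by
  obtain ⟨M, t, hd, hc, hx⟩ := h x
  refine ⟨M, t, hd, hc, ?_⟩
  have h0 : eval (x - of t) = 0 := relations_le_ker_eval_holds hx
  rw [map_sub, eval_of, sub_eq_zero] at h0
  exact h0.symm

/-- **SANDWICH, upper half**: the kernel conjecture and the value-level theorem give the crux
outright. [cite: KontsevichZagier2001, §1.2 Conjecture 1] -/
theorem continuousCubification_of_kernel (hK : KZKernelConjecture) (hV : ValueCubification) :
    ContinuousCubification := fun x => by
  obtain ⟨M, t, hd, hc, hv⟩ := hV x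
  refine ⟨M, t, hd, hc, hK _ ?_⟩
  rw [map_sub, eval_of, hv, sub_self]

/-- **Modulo the printed value-level theorem, refuting the crux refutes the summit**
(`KZKernelConjecture ↔ KontsevichZagierPeriods`, tree). So the crux is not cheaper to kill than
Kontsevich–Zagier's Conjecture 1 itself; the GPC-strength barriers apply to any would-be
invariant. [cite: KontsevichZagier2001, §1.2 Conjecture 1] -/
theorem not_summit_of_not_continuousCubification (hV : ValueCubification)
    (h : ¬ ContinuousCubification) : ¬ _root_.KontsevichZagierPeriods := fun hS =>
  h (continuousCubification_of_kernel
    ((kzKernelConjecture_iff_isRational.trans KontsevichZagierPeriods_iff.symm).2 hS) hV)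

/-! ## §B Tightness: the crux minus continuity is a theorem (landed) -/

/-- **The unrestricted (indeed bounded) one-cube normal form holds** — landed stub
`stub_cubifyKernel` (p120281). So CONTINUITY ON THE CLOSED CUBE is the entire content of the crux;
a refutation must be an invariant that sees the boundary behaviour of cube integrands.
[cite: KontsevichZagier2001, §1.2] -/
theorem cubeNormalForm_relations : CubeNormalForm relations := fun x => by
  obtain ⟨M, t, hd, -, hx⟩ := stub_cubifyKernel x
  exact ⟨M, t, hd, hx⟩

/-! ### §B.2 The corner obstruction: open-cube continuity does not close up -/

/-- The corner function is bounded on the open square: `0 ≤ 2x²/(x²+y²) ≤ 2`. [folklore] -/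
theorem corner_mem_Icc (x : Fin 2 → ℝ) (hx : x ∈ Set.pi Set.univ (fun _ : Fin 2 => Set.Ioo (0:ℝ) 1)) :
    2 * x 0 ^ 2 / (x 0 ^ 2 + x 1 ^ 2) ∈ Icc (0:ℝ) 2 := by
  rw [Set.mem_univ_pi] at hx
  have h0 := (hx 0).1
  have hpos : 0 < x 0 ^ 2 + x 1 ^ 2 := by positivity
  constructor
  · positivity
  · rw [div_le_iff₀ hpos]
    nlinarith [sq_nonneg (x 1)]

/-- The corner function is continuous on the open square (denominator `> 0` there). [folklore] -/
theorem continuousOn_corner :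
    ContinuousOn (fun x : Fin 2 → ℝ => 2 * x 0 ^ 2 / (x 0 ^ 2 + x 1 ^ 2))
      (Set.pi Set.univ (fun _ : Fin 2 => Set.Ioo (0:ℝ) 1)) := by
  refine ContinuousOn.div (by fun_prop) (by fun_prop) fun x hx => ?_
  rw [Set.mem_univ_pi] at hx
  have h0 := (hx 0).1
  positivity

/-- The corner function is `ℚ`-semialgebraic on the open square (a quotient of `ℚ`-polynomials with
non-vanishing denominator; tree `isSemialgebraicFunOn_aeval_div_aeval`). [folklore] -/
theorem isSemialgebraicFunOn_corner :
    IsSemialgebraicFunOn ℚ (Set.pi Set.univ (fun _ : Fin 2 => Set.Ioo (0:ℝ) 1))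
      (fun x : Fin 2 → ℝ => 2 * x 0 ^ 2 / (x 0 ^ 2 + x 1 ^ 2)) := by
  have hσ : IsSemialgebraic ℚ (Set.pi Set.univ (fun _ : Fin 2 => Set.Ioo (0:ℝ) 1)) := by
    have h := KZ.isSemialgebraic_box 2
    convert h using 1
    ext x
    simp
  have hq : ∀ x ∈ Set.pi Set.univ (fun _ : Fin 2 => Set.Ioo (0:ℝ) 1),
      aeval x (X 0 ^ 2 + X 1 ^ 2 : MvPolynomial (Fin 2) ℚ) ≠ 0 := by
    intro x hx
    rw [Set.mem_univ_pi] at hx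
    have h0 := (hx 0).1
    simp only [map_add, map_pow, MvPolynomial.aeval_X]
    positivity
  refine (isSemialgebraicFunOn_aeval_div_aeval hσ (C 2 * X 0 ^ 2) (X 0 ^ 2 + X 1 ^ 2) hq).congr
    fun x _ => ?_
  simp [map_add, map_pow, MvPolynomial.aeval_X]

/-- **THE CORNER OBSTRUCTION.** No function continuous on the closed unit square agrees with
`2x²/(x²+y²)` on the open square: along the diagonal `(s,s)` the values are `1`, along the parabola
`(s,s²)` they are `2/(1+s²) → 2`, and both curves run inside the open square into the corner `0`.
Hence "bounded + continuous on the OPEN cube" (free from cylindrical decomposition) is strictly weaker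
than the crux's "continuous on the CLOSED cube" at the level of single representations; the gap is
closed only by a further move. [folklore] -/
theorem not_exists_continuousOn_closedSquare_extension :
    ¬ ∃ G : (Fin 2 → ℝ) → ℝ, ContinuousOn G (Set.pi Set.univ (fun _ : Fin 2 => Set.Icc (0:ℝ) 1)) ∧
      EqOn G (fun x => 2 * x 0 ^ 2 / (x 0 ^ 2 + x 1 ^ 2))
        (Set.pi Set.univ (fun _ : Fin 2 => Set.Ioo (0:ℝ) 1)) := by
  rintro ⟨G, hG, hEq⟩
  set Q : Set (Fin 2 → ℝ) := Set.pi Set.univ (fun _ : Fin 2 => Set.Icc (0:ℝ) 1) with hQ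
  set U : Set (Fin 2 → ℝ) := Set.pi Set.univ (fun _ : Fin 2 => Set.Ioo (0:ℝ) 1) with hU
  have h0Q : (0 : Fin 2 → ℝ) ∈ Q := by
    rw [hQ, Set.mem_univ_pi]
    intro i
    exact ⟨le_rfl, zero_le_one⟩
  have hcont : Tendsto G (𝓝[Q] 0) (𝓝 (G 0)) := hG 0 h0Q
  -- two curves into the corner, inside the open square for `s ∈ (0,1)`
  have hIoo : ∀ᶠ s in 𝓝[>] (0:ℝ), s ∈ Ioo (0:ℝ) 1 :=
    Ioo_mem_nhdsGT zero_lt_one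
  have hγ₁U : ∀ s ∈ Ioo (0:ℝ) 1, (![s, s] : Fin 2 → ℝ) ∈ U := by
    intro s hs
    rw [hU, Set.mem_univ_pi]
    intro i
    fin_cases i <;> simpa using hs
  have hγ₂U : ∀ s ∈ Ioo (0:ℝ) 1, (![s, s ^ 2] : Fin 2 → ℝ) ∈ U := by
    intro s hs
    rw [hU, Set.mem_univ_pi]
    intro i
    fin_cases i
    · simpa using hs
    · have hs0 := hs.1
      have hs1 := hs.2
      simp only [Fin.mk_one, Matrix.cons_val_one, Matrix.cons_val_fin_one, mem_Ioo]
      exact ⟨by positivity, by nlinarith⟩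
  have hUQ : U ⊆ Q := by
    rw [hU, hQ]
    exact Set.pi_mono fun _ _ => Ioo_subset_Icc_self
  -- the curves tend to the corner within `Q`
  have hγ₁ : Tendsto (fun s : ℝ => (![s, s] : Fin 2 → ℝ)) (𝓝[>] 0) (𝓝[Q] 0) := by
    refine tendsto_nhdsWithin_iff.2 ⟨?_, hIoo.mono fun s hs => hUQ (hγ₁U s hs)⟩
    have hc : Continuous (fun s : ℝ => (![s, s] : Fin 2 → ℝ)) := by fun_prop
    have h := hc.tendsto 0
    have h00 : (![(0:ℝ), 0] : Fin 2 → ℝ) = 0 := by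
      ext i; fin_cases i <;> simp
    rw [h00] at h
    exact h.mono_left nhdsWithin_le_nhds
  have hγ₂ : Tendsto (fun s : ℝ => (![s, s ^ 2] : Fin 2 → ℝ)) (𝓝[>] 0) (𝓝[Q] 0) := by
    refine tendsto_nhdsWithin_iff.2 ⟨?_, hIoo.mono fun s hs => hUQ (hγ₂U s hs)⟩
    have hc : Continuous (fun s : ℝ => (![s, s ^ 2] : Fin 2 → ℝ)) := by fun_prop
    have h := hc.tendsto 0
    have h00 : (![(0:ℝ), 0 ^ 2] : Fin 2 → ℝ) = 0 := by
      ext i; fin_cases i <;> simp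
    rw [h00] at h
    exact h.mono_left nhdsWithin_le_nhds
  -- along the diagonal `G = 1`, along the parabola `G = 2/(1+s²)`
  have h1 : Tendsto (fun s : ℝ => G ![s, s]) (𝓝[>] 0) (𝓝 1) := by
    refine (tendsto_const_nhds (x := (1:ℝ))).congr' (hIoo.mono fun s hs => ?_)
    show (1:ℝ) = G ![s, s]
    rw [hEq (hγ₁U s hs)]
    have hs0 : s ≠ 0 := hs.1.ne'
    simp only [Matrix.cons_val_zero, Matrix.cons_val_one, Matrix.cons_val_fin_one]
    field_simp
    ring
  have h2 : Tendsto (fun s : ℝ => G ![s, s ^ 2]) (𝓝[>] 0) (𝓝 2) := by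
    have hlim : Tendsto (fun s : ℝ => 2 / (1 + s ^ 2)) (𝓝[>] 0) (𝓝 2) := by
      have hc : Continuous (fun s : ℝ => 2 / (1 + s ^ 2)) :=
        Continuous.div continuous_const (by fun_prop) fun s => by positivity
      have h := hc.tendsto 0
      norm_num at h
      exact h.mono_left nhdsWithin_le_nhds
    refine hlim.congr' (hIoo.mono fun s hs => ?_)
    show 2 / (1 + s ^ 2) = G ![s, s ^ 2]
    rw [hEq (hγ₂U s hs)]
    have hs0 : s ≠ 0 := hs.1.ne'
    simp only [Matrix.cons_val_zero, Matrix.cons_val_one, Matrix.cons_val_fin_one]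
    field_simp
  have e1 : G 0 = 1 := tendsto_nhds_unique (hcont.comp hγ₁) h1
  have e2 : G 0 = 2 := tendsto_nhds_unique (hcont.comp hγ₂) h2
  linarith


/-! ## §A Load-bearing analysis: which move sets a proof must use

`rulesOneTwo = closure ((1a) ∪ (1b) ∪ (2))`, `rulesOneThree = closure ((1a) ∪ (1b) ∪ (3))`,
`rulesNoDomainAdd = closure ((1b) ∪ (2) ∪ (3))` are the tree's subgroups
(`CompleteModGammaSectorNegative`). -/

/-! ### §A.3 Rule (3), Newton–Leibniz: load-bearing (unconditional) -/

/-- **Without Newton–Leibniz there is no single-representation normal form at all.** The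
dimension-0 evaluation `ev₀` and the full evaluation `eval` both kill rules (1a), (1b), (2); on
`x = [pt, 1] + [[0,1], 1]` they read `1` and `2`. If `x − [t] ∈ rulesOneTwo` with `t` of dimension
`M`: for `M = 0`, `ev₀` gives `t.value = 1` and `eval` gives `t.value = 2`; for `M ≥ 1`, `ev₀` gives
`1 = 0`. [cite: KontsevichZagier2001, §1.2 rule (3)] -/
theorem not_singleRepNormalForm_rulesOneTwo : ¬ SingleRepNormalForm rulesOneTwo := by
  intro h
  obtain ⟨M, t, ht⟩ := h (of (constRep 1) + of unitIntervalRep)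
  have h0 : ev₀ (of (constRep 1) + of unitIntervalRep - of t) = 0 := rulesOneTwo_le_ker_ev₀ ht
  have h1 : eval (of (constRep 1) + of unitIntervalRep - of t) = 0 :=
    relations_le_ker_eval_holds (rulesOneTwo_le_relations ht)
  rw [map_sub, map_add, ev₀_of_zero, constRep_value, ev₀_of_eq_zero one_ne_zero unitIntervalRep]
    at h0
  rw [map_sub, map_add, eval_of, eval_of, eval_of, constRep_value, unitIntervalRep_value] at h1
  rcases Nat.eq_zero_or_pos M with hM | hM
  · rw [ev₀_of_eq_value hM] at h0
    push_cast at h0 h1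
    linarith
  · rw [ev₀_of_eq_zero hM.ne'] at h0
    push_cast at h0
    linarith

/-- A fortiori no cube normal form without rule (3). [folklore] -/
theorem not_cubeNormalForm_rulesOneTwo : ¬ CubeNormalForm rulesOneTwo := fun h =>
  not_singleRepNormalForm_rulesOneTwo (singleRepNormalForm_of_cubeNormalForm h)

/-- The crux with rule (3) removed from the move set. -/
def ContinuousCubificationWithoutNewtonLeibniz : Prop := ContinuousCubificationMod rulesOneTwo

/-- **NEWTON–LEIBNIZ IS LOAD-BEARING for `ContinuousCubification`** (unconditional).
[cite: KontsevichZagier2001, §1.2 rule (3)] -/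
theorem continuousCubification_false_without_newtonLeibniz :
    ¬ ContinuousCubificationWithoutNewtonLeibniz := fun h =>
  not_cubeNormalForm_rulesOneTwo (cubeNormalForm_of_continuousCubificationMod h)

/-! ### §A.2 Rule (2), change of variables: load-bearing (unconditional) -/

/-- **Every closed-cube representation lies in `covKer`**: its domain sits in `{x₀ ≤ 1}`, so its
first-coordinate distribution function is constant (`= value`) on the window `[2,3]`; in dimension
`0` it is `0`. [folklore] -/
theorem of_cube_mem_covKer {M : ℕ} (t : IntegralRep M) (ht : t.domain = cube M) :
    of t ∈ covKer := by
  rcases Nat.eq_zero_or_pos M with hM | hM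
  · rw [mem_covKer_iff, Cdf_of_eq_zero hM]
    exact WindowSemialg.zero
  · refine of_mem_covKer_of_first_le_two hM t fun x hx => ?_
    rw [ht, Set.mem_univ_pi] at hx
    have h01 := (hx ⟨0, hM⟩).2
    linarith

/-- `[[0,1], 1/(2−t)]` lies in `covKer` (its distribution function is constant on the window).
[folklore] -/
theorem of_r₀_mem_covKer : of r₀ ∈ covKer := by
  rw [mem_covKer_iff]
  exact WindowSemialg.of_const r₀.value fun s hs => Cdf_r₀ hs

/-- **`[[2,3], 1/(4−t)]` does NOT lie in `covKer`**: its distribution function on the window is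
`log 2 − log (2 − s)`, not `ℝ`-semialgebraic (tree: `witness_not_mem_covKer`, from the barrier
`noRealSemialgebraicPrimitive_inv_sub_two`). [cite: Ayoub2015, Rem. 1.2] -/
theorem of_r₀'_not_mem_covKer : of r₀' ∉ covKer := fun h =>
  witness_not_mem_covKer (covKer.sub_mem of_r₀_mem_covKer h)

/-- **Without change of variables there is no cube normal form** (continuous, bounded or
otherwise): `rulesOneThree ≤ covKer` (tree), every closed-cube representation lies in `covKer`,
but `[[2,3], 1/(4−t)]` does not. Rule (2) is needed already to move a domain into the unit cube.
[cite: KontsevichZagier2001, §1.2 rule (2)] -/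
theorem not_cubeNormalForm_rulesOneThree : ¬ CubeNormalForm rulesOneThree := by
  intro h
  obtain ⟨M, t, htd, ht⟩ := h (of r₀')
  have h1 : of r₀' - of t ∈ covKer := rulesOneThree_le_covKer ht
  have h2 : of r₀' - of t + of t ∈ covKer := covKer.add_mem h1 (of_cube_mem_covKer t htd)
  rw [sub_add_cancel] at h2
  exact of_r₀'_not_mem_covKer h2

/-- The crux with rule (2) removed from the move set. -/
def ContinuousCubificationWithoutChangeOfVariables : Prop := ContinuousCubificationMod rulesOneThree

/-- **CHANGE OF VARIABLES IS LOAD-BEARING for `ContinuousCubification`** (unconditional).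
[cite: KontsevichZagier2001, §1.2 rule (2)] -/
theorem continuousCubification_false_without_changeOfVariables :
    ¬ ContinuousCubificationWithoutChangeOfVariables := fun h =>
  not_cubeNormalForm_rulesOneThree (cubeNormalForm_of_continuousCubificationMod h)

/-! ### §A.1a Rule (1a), domain additivity: load-bearing modulo van den Dries Ch. 4 (2.4) -/

/-- Membership in the closed cube of `ℝ^{M+1}` splits along `Fin.append`. [folklore] -/
theorem append_mem_cube_iff {M : ℕ} (a : Fin M → ℝ) (y : Fin 1 → ℝ) :
    (Fin.append a y : Fin (M + 1) → ℝ) ∈ cube (M + 1) ↔ a ∈ cube M ∧ y 0 ∈ Icc (0:ℝ) 1 := by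
  simp only [cube, Set.mem_univ_pi]
  rw [Fin.forall_fin_add]
  simp only [Fin.append_left, Fin.append_right, Fin.forall_fin_one]

/-- **`E([0,1]^M) = 1`** (o-minimal Euler characteristic; fibre formula with closed fibres `[0,1]`
of Euler characteristic `1`, induction on `M`). NEW (the tree had the open cube, `(−1)^M`).
[cite: Dries1998, Ch. 4 (2.11)] -/
theorem realEuler_closedCube : ∀ M : ℕ, realEuler M (cube M) = 1
  | 0 => by
    have h := realEuler_box (m := 0) Fin.elim0 Fin.elim0 (fun i => i.elim0)
    have hset : {v : Fin 0 → ℝ | ∀ i, Fin.elim0 i < v i ∧ v i < Fin.elim0 i} = cube 0 := by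
      ext v
      simp [cube]
    rwa [hset, pow_zero] at h
  | M + 1 => by
    have hS : (univ : Set ℝ).Definable Language.orderedRing (cube (M + 1)) :=
      definable_univ_of_isSemialgebraic (isSemialgebraic_cubePi (M + 1))
    have hproj : {a : Fin M → ℝ | ∃ y : Fin 1 → ℝ, (Fin.append a y : Fin (M + 1) → ℝ) ∈ cube (M + 1)}
        = cube M := by
      ext a
      simp only [mem_setOf_eq, append_mem_cube_iff]
      constructor
      · rintro ⟨y, hy⟩
        exact hy.1
      · intro ha
        exact ⟨fun _ => 0, ha, le_rfl, zero_le_one⟩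
    rw [realEuler, eulerChar_eq_eulerChar_proj_mul isOMinimal_real definable_lt_real hS (e := 1)
      fun a ⟨y, hy⟩ => ?_, hproj, mul_one]
    · exact realEuler_closedCube M
    · have ha : a ∈ cube M := ((append_mem_cube_iff a y).1 hy).1
      have hset : {y : Fin 1 → ℝ | (Fin.append a y : Fin (M + 1) → ℝ) ∈ cube (M + 1)} =
          {y | (0:ℝ) ≤ y 0 ∧ y 0 ≤ 1} := by
        ext y
        simp only [mem_setOf_eq, append_mem_cube_iff, mem_Icc]
        exact ⟨fun h => h.2, fun h => ⟨ha, h⟩⟩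
      rw [hset]
      exact realEuler_Icc zero_le_one

/-- **Every closed-cube representation is killed by the Euler-parity-weighted evaluation**
(`E([0,1]^M) = 1` is odd; unconditional). [folklore] -/
theorem evenEulerEval_of_cube {M : ℕ} (t : IntegralRep M) (ht : t.domain = cube M) :
    evenEulerEval (of t) = 0 := by
  have h1 : ¬ Even (realEuler M t.domain) := by
    rw [ht, realEuler_closedCube M, Int.not_even_iff_odd]
    exact odd_one
  rw [evenEulerEval_of, if_neg h1]

/-- **Without domain additivity there is no cube normal form**, modulo van den Dries Ch. 4 (2.4)
(Euler invariance under injective definable maps, the named fact rule (2) needs to preserve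
`evenEulerEval`): `evenEulerEval` kills rules (1b), (2), (3) and every closed-cube generator, but
reads `2` on `[[0,1]∪[2,3], 1]` (`E = 2`, value `2`). [cite: Dries1998, Ch. 4 (2.4)] -/
theorem not_cubeNormalForm_rulesNoDomainAdd (hE : Dries1998_ch4_prop_2_4 Language.orderedRing ℝ) :
    ¬ CubeNormalForm rulesNoDomainAdd := by
  intro h
  obtain ⟨M, t, htd, ht⟩ := h (of twoIntervalsRep)
  have h0 : evenEulerEval (of twoIntervalsRep - of t) = 0 := rulesNoDomainAdd_le_ker hE ht
  have h2 : evenEulerEval (of twoIntervalsRep) = 2 := by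
    have hw := evenEulerEval_witness
    rw [map_sub] at hw
    have h1 : ¬ Even (realEuler 1 oneIntervalRep.domain) := by
      rw [realEuler_oneInterval, Int.not_even_iff_odd]
      exact odd_one
    rw [evenEulerEval_of oneIntervalRep, if_neg h1, sub_zero] at hw
    exact hw
  rw [map_sub, h2, evenEulerEval_of_cube t htd] at h0
  norm_num at h0

/-- The crux with rule (1a) removed from the move set. -/
def ContinuousCubificationWithoutDomainAdd : Prop := ContinuousCubificationMod rulesNoDomainAdd

/-- **DOMAIN ADDITIVITY IS LOAD-BEARING for `ContinuousCubification`** (modulo van den Dries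
Ch. 4 (2.4)). [cite: Dries1998, Ch. 4 (2.4)] -/
theorem continuousCubification_false_without_domainAdd
    (hE : Dries1998_ch4_prop_2_4 Language.orderedRing ℝ) :
    ¬ ContinuousCubificationWithoutDomainAdd := fun h =>
  not_cubeNormalForm_rulesNoDomainAdd hE (cubeNormalForm_of_continuousCubificationMod h)

/-! ### §A.1b Rule (1b), integrand additivity: redundant -/

/-- The subgroup generated by rules (1a), (2), (3) — everything except integrand additivity. -/
def rulesNoIntegrandAdd : AddSubgroup FormalRep :=
  AddSubgroup.closure (domainAddRel ∪ changeOfVariablesRel ∪ newtonLeibnizRel)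

/-- Rule (1b) is derivable from (1a) and (3) (tree: `relations_eq_closure_three_rules`, band/gluing
construction), so removing it changes nothing. [cite: KontsevichZagier2001, §1.2 rule (1)] -/
theorem rulesNoIntegrandAdd_eq_relations : rulesNoIntegrandAdd = relations :=
  (Summit.KontsevichZagierPeriods.Theorems.StuffleInKZ.Negative.Derived.relations_eq_closure_three_rules).symm

/-- The crux with rule (1b) removed from the move set. -/
def ContinuousCubificationWithoutIntegrandAdd : Prop := ContinuousCubificationMod rulesNoIntegrandAdd

/-- **Integrand additivity is NOT load-bearing**: the crux without rule (1b) is equivalent to the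
crux. [cite: KontsevichZagier2001, §1.2 rule (1)] -/
theorem continuousCubification_iff_without_integrandAdd :
    ContinuousCubificationWithoutIntegrandAdd ↔ ContinuousCubification := by
  rw [ContinuousCubificationWithoutIntegrandAdd, rulesNoIntegrandAdd_eq_relations]
  rfl

/-! ## §C Natural strengthenings -/

/-- SIGN-RESPECTING continuous cubification: the normal form's integrand is non-negative whenever
the value is. A natural request (volumes!) — and summit-hard, see below. -/
def SignedContinuousCubification : Prop :=
  ∀ x : FormalRep, 0 ≤ eval x → ∃ (M : ℕ) (t : IntegralRep M),
    t.domain = cube M ∧ ContinuousOn t.integrand t.domain ∧ (∀ z ∈ t.domain, 0 ≤ t.integrand z) ∧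
      x - of t ∈ relations

/-- The closed cube is contained in the closure of its interior. [folklore] -/
theorem cube_subset_closure_interior (M : ℕ) : cube M ⊆ closure (interior (cube M)) := by
  rw [interior_pi_set Set.finite_univ, closure_pi_set]
  intro x hx
  rw [Set.mem_univ_pi] at hx ⊢
  intro i
  rw [interior_Icc, closure_Ioo zero_ne_one]
  exact hx i

/-- A continuous non-negative integrand on the closed cube with integral `0` vanishes on the
closed cube. [folklore] -/
theorem eqOn_zero_of_nonneg_of_value_eq_zero {M : ℕ} (t : IntegralRep M) (ht : t.domain = cube M)
    (hc : ContinuousOn t.integrand t.domain) (hnn : ∀ z ∈ t.domain, 0 ≤ t.integrand z)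
    (hv : t.value = 0) : EqOn t.integrand 0 t.domain := by
  have hmeas : MeasurableSet t.domain := IntegralRep.measurableSet_domain_holds t
  have hae : t.integrand =ᵐ[volume.restrict t.domain] 0 := by
    refine (setIntegral_eq_zero_iff_of_nonneg_ae ?_ t.integrableOn).1 hv
    exact (ae_restrict_iff' hmeas).2 (Filter.Eventually.of_forall hnn)
  have h := Measure.eqOn_of_ae_eq hae hc continuousOn_const (by rw [ht]; exact cube_subset_closure_interior M)
  exact h

/-- **The sign-respecting strengthening implies the kernel conjecture** (hence the summit, tree
`KernelImpliesStatement`): for `eval x = 0` the normal form is a non-negative continuous integrand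
of integral `0` on the closed cube, i.e. `0`, so `[t] ∈ relations` and `x ∈ relations`. The crux
itself asserts nothing about signs; planners should not strengthen it this way.
[cite: KontsevichZagier2001, §1.2 Conjecture 1] -/
theorem kzKernelConjecture_of_signed (h : SignedContinuousCubification) : KZKernelConjecture := by
  intro x hx
  obtain ⟨M, t, htd, htc, hnn, hrel⟩ := h x hx.ge
  have hv : t.value = 0 := by
    have h0 : eval (x - of t) = 0 := relations_le_ker_eval_holds hrel
    rw [map_sub, hx, eval_of, zero_sub, neg_eq_zero] at h0
    exact h0
  have ht0 : of t ∈ relations :=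
    of_mem_relations_of_eqOn_zero t (eqOn_zero_of_nonneg_of_value_eq_zero t htd htc hnn hv)
  have : x = (x - of t) + of t := by abel
  rw [this]
  exact relations.add_mem hrel ht0

/-! ## §D Targets (registered skeleton `Lines/c0_cubification.lean`; payload.targets = ∅)

Per-stub attack notes (no stub broken this cycle):

* `stub_c1TriangulationRat : C1TriangulationRat` — the `ℚ`-scope Ohmoto–Shiota theorem. Typed
  form read against arXiv:1505.03970 §1.1/Thm 1.1 (vendored `ℝ`-form
  `OhmotoShiota2017_c1Triangulation`): global `ContDiff ℝ 1 f` is what the paper gives ("we can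
  extend it to `Rᵐ → Rⁿ`"; a `C¹` map on a neighbourhood of the compact `|K|` times a semialgebraic
  `C¹` bump); algebraic vertices are free (rational barycentric subdivision); `IsSemialgHomeomorphOn ℚ`
  follows by running the proof over the real closure of `ℚ` and transferring (bijectivity,
  bicontinuity, `C¹`-ness of a fixed definable family member are first order). Degenerate inputs:
  `X = ∅` (empty complex, `⊥ : SimplicialComplex`), `X` a point (one vertex, constant `f`), `N = 0`
  — all satisfiable. NO rank/immersion clause is typed (the paper's open question), so the known
  obstruction does not bite. Verdict: a printed theorem; not attackable by counterexample.
* `stub_cubifyCompactSolidPair` — SAME-dimension output `c : IntegralRep N`. Checked: `N = 0`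
  (domains `∅`/`pt`, `c = [pt, q]`, `q ∈ {−1,0,1}`), `N = 1` (finite unions of closed intervals),
  solids with empty interior (null, `c = [□, 0]`), ambient dimension `n ≠ N` of `K` (top simplices
  are `N`-simplices by invariance of dimension, lower ones have null `C¹` images; charts
  `f ∘ A_σ ∘ P : ℝᴺ → ℝᴺ` with `A_σ` affine onto `σ ⊆ ℝⁿ`), rank drop of `d(f|σ)` on `∂σ` (rule (2) as
  typed = `integral_image_eq_integral_abs_det_fderiv_smul`: injectivity + `HasFDerivWithinAt` only),
  `ℚ`-semialgebraicity of `|det D(f ∘ A_σ ∘ P)|` (derivative of a `ℚ`-semialgebraic `C¹` map; tree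
  `SemialgebraicLineDeriv`). No defect found. JOINT SUFFICIENCY: `ContinuousCubification_of` is a real
  composition (kernel-checked in the skeleton).
* Alternative line (ideators, korobov-damping): `[□°, g]`, `g` bounded and continuous on the OPEN
  cube ⇒ crux, by one rule-(2) move `Φ = (3u²−2u³)` coordinatewise (Jacobian `∏ 6uᵢ(1−uᵢ)` vanishes
  on `∂□`, so `(g ∘ Φ)·J` extends by `0`); the open-cube normal form needs only `C¹`-CAD flattening of
  the landed bounded normal form. Attack surface for the disprover there: none beyond `C¹`-CAD over `ℚ`.
-/

/-! ## §E Near-misses — none. -/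

end Summit.KontsevichZagierPeriods.KontsevichZagierPeriods.Cruxes.ContinuousCubification.Disproof

end
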